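import Summits.QuantumFields.YangMills.Theorems.BalabanLadderNTReferenceTransfer
import Literature.Probability.Moments.OscillationCovariance
import HarnessLib

/-!
# Seam `UVSeamRec` (stmt-QuantumFields-20043): TEMPERED laws of total covariance — oscillation bounds only on a GOOD set
# of exteriors, plus a rarity remainder (generic layer for the tempered twins of the reference-state transfer)

Helper file (`--supports stmt-QuantumFields-20043`; owner R78: seam currency №1, three-point conjunct supplier; lead
ym-spine-20043-p1 g7 09:44Z located suggestion «the TEMPERED twin of `Reference.abs_torusCov_sub_kerCov_le` /
`abs_torusK3_sub_kerK3_le` (oscillations only over a measurable good set of exterior pairs + a μ_T-rarity remainder)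
would make (E1/E2/E3-osc) consumable in the same tempered currency as p519295») of the fleet lead prover of crux `NT`
(unit `ym-spine-19353-p1`, g5); route-independent.  CLAUSES SERVED: conjuncts 2 and 3 of the registered v4-F
`stub_floorsEngine` in TEMPERED currency — the ∀-exterior ceilings E1/E2/E3-osc of the reference package are
(likely) FALSE as typed (lead p518535 `not_e1osc_of_densPenetration`, seam-s2 CEILINGS note 39baed2d52a8bef1 §2–3:
coherent / self-dual flux exteriors penetrate), so every transfer must be re-run with the oscillation assumed only on a
measurable GOOD set `S` of the conditioning variable and the complement paid for by its (small) mass `δ`.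

Generic layer (compact `Ω`, probability `μ`, continuous `g`'s bounded by `M`'s, `S` measurable, `μ.real Sᶜ ≤ δ`; the
tempered twins of §1 of `…NTReferenceTransfer.lean`, g4):

* `abs_sub_integral_le_of_osc_on` — `ω ∈ S`, `osc_S g ≤ h` ⇒ `|g ω − ∫ g| ≤ h + 2Mδ`;
* `abs_integral_sub_integral_le_of_osc_on` — two states: `|∫ g dμ − ∫ g' dν| ≤ ω + 2M(δ + δ')`;
* **`abs_cov_sub_integral_condCov_le_of_osc_on`** — tempered two-sided law of total covariance:
  `|Cov − ∫ condCov| ≤ (h + 2M_Aδ)(h' + 2M_Bδ) + 4 M_A M_B δ` (g4's `h h'` at `δ = 0`).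

(The one-sided tempered law of total covariance `Literature.Probability.Moments.total_covariance_lower_bound` is
the floor-side cousin; here the two-sided transfer form.)  The torus specialisations (tempered `abs_torusCov_sub_torusE_kerCov_le` / `abs_torusCov_sub_torusCov_le`, with
`S = lift⁻¹(Good)` for a measurable set `Good` of exteriors of the transfer cube and `δ` = its rarity under Wilson's
measure on each torus) follow in `…NTReferenceTorusTempered.lean`; the third-cumulant twin is the successor's.

Refs: lead line fleet INBOX 2026-08-27T09:44:53Z; seam-s2 `CEILINGS-KERNEL-ANALYSIS-seam-s2.md` §4 (tempered kernel law +
multiplicative rarity, p518354/p519295); g4 `…NTReferenceTransfer.lean` §1.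
-/

set_option autoImplicit false

noncomputable section

open MeasureTheory Filter Topology
open Summit.QuantumFields.YangMills.Theorems.OSLegsFromFemtoAndGap.StubLower (integrable_of_continuous_compact)
open Literature.Probability.Moments (abs_integral_le_of_forall_abs_le)

namespace Summit.QuantumFields.YangMills.Cruxes.NT.Reference

section MomentsOn

variable {Ω : Type*} [TopologicalSpace Ω] [CompactSpace Ω] [MeasurableSpace Ω]
  [OpensMeasurableSpace Ω] {μ : Measure Ω} [IsProbabilityMeasure μ]

omit [TopologicalSpace Ω] [CompactSpace Ω] [OpensMeasurableSpace Ω] in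
/-- `∫ (c₀ + c·1_{T}) dμ = c₀ + c·μ(T)` on a probability space. [folklore] -/
theorem integral_const_add_mul_indicator {T : Set Ω} (hT : MeasurableSet T) (c₀ c : ℝ) :
    ∫ ω, (c₀ + c * T.indicator (fun _ => (1 : ℝ)) ω) ∂μ = c₀ + c * μ.real T := by
  have i1 : Integrable (T.indicator fun _ => (1 : ℝ)) μ := (integrable_const (1 : ℝ)).indicator hT
  rw [integral_add (integrable_const c₀) (i1.const_mul c), integral_const, integral_const_mul,
    integral_indicator_const (1 : ℝ) hT]
  simp

omit [TopologicalSpace Ω] [CompactSpace Ω] [OpensMeasurableSpace Ω] in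
/-- The integrand `c₀ + c·1_{T}` is integrable. [folklore] -/
theorem integrable_const_add_mul_indicator {T : Set Ω} (hT : MeasurableSet T) (c₀ c : ℝ) :
    Integrable (fun ω => c₀ + c * T.indicator (fun _ => (1 : ℝ)) ω) μ :=
  (integrable_const c₀).add (((integrable_const (1 : ℝ)).indicator hT).const_mul c)

/-- **Tempered: a function whose oscillation ON `S` is `≤ h` is within `h + 2Mδ` of its mean at every point of `S`**
(`|g| ≤ M`, `μ(Sᶜ) ≤ δ`). [folklore] -/
theorem abs_sub_integral_le_of_osc_on {g : Ω → ℝ} (hg : Continuous g) {S : Set Ω} (hS : MeasurableSet S)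
    {h M δ : ℝ} (hM : ∀ ω, |g ω| ≤ M) (hosc : ∀ ω ∈ S, ∀ ω' ∈ S, |g ω - g ω'| ≤ h) (hδ : μ.real Sᶜ ≤ δ)
    {ω : Ω} (hω : ω ∈ S) : |g ω - ∫ ω', g ω' ∂μ| ≤ h + 2 * M * δ := by
  have hh : 0 ≤ h := by simpa using hosc ω hω ω hω
  have hM0 : 0 ≤ M := (abs_nonneg _).trans (hM ω)
  have i1 : Integrable g μ := integrable_of_continuous_compact hg
  have e : g ω - ∫ ω', g ω' ∂μ = ∫ ω', (g ω - g ω') ∂μ := by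
    rw [integral_sub (integrable_const _) i1, integral_const]; simp
  rw [e, ← Real.norm_eq_abs]
  have hpt : ∀ᵐ ω' ∂μ, ‖g ω - g ω'‖ ≤ h + 2 * M * Sᶜ.indicator (fun _ => (1 : ℝ)) ω' :=
    ae_of_all _ fun ω' => by
      rw [Real.norm_eq_abs]
      by_cases hω' : ω' ∈ S
      · have : Sᶜ.indicator (fun _ => (1 : ℝ)) ω' = 0 := Set.indicator_of_notMem (by simpa using hω') _
        rw [this, mul_zero, add_zero]
        exact hosc ω hω ω' hω'
      · have : Sᶜ.indicator (fun _ => (1 : ℝ)) ω' = 1 := Set.indicator_of_mem (by simpa using hω') _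
        rw [this, mul_one]
        calc |g ω - g ω'| ≤ |g ω| + |g ω'| := abs_sub _ _
          _ ≤ M + M := add_le_add (hM ω) (hM ω')
          _ ≤ h + 2 * M := by linarith
  have key := norm_integral_le_of_norm_le (integrable_const_add_mul_indicator hS.compl h (2 * M)) hpt
  rw [integral_const_add_mul_indicator hS.compl] at key
  calc ‖∫ ω', (g ω - g ω') ∂μ‖ ≤ h + 2 * M * μ.real Sᶜ := key
    _ ≤ h + 2 * M * δ := by nlinarith [measureReal_nonneg (μ := μ) (s := Sᶜ)]

omit [IsProbabilityMeasure μ] in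
/-- **Tempered: two states average a function to within its GOOD-set oscillation plus rarity.**  Probability measures
`μ` on `Ω`, `ν` on `Ω'`, continuous `g, g'` bounded by `M`, measurable `S ⊆ Ω`, `S' ⊆ Ω'` with `μ(Sᶜ) ≤ δ`,
`ν(S'ᶜ) ≤ δ'`, and `|g u − g' v| ≤ ω` for `u ∈ S`, `v ∈ S'` (`ω ≥ 0`): `|∫ g dμ − ∫ g' dν| ≤ ω + 2M(δ + δ')`.
[folklore] -/
theorem abs_integral_sub_integral_le_of_osc_on [IsProbabilityMeasure μ] {Ω' : Type*} [TopologicalSpace Ω']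
    [CompactSpace Ω'] [MeasurableSpace Ω'] [OpensMeasurableSpace Ω'] {ν : Measure Ω'} [IsProbabilityMeasure ν]
    {g : Ω → ℝ} {g' : Ω' → ℝ} (hg : Continuous g) (hg' : Continuous g') {S : Set Ω} {S' : Set Ω'}
    (hS : MeasurableSet S) (hS' : MeasurableSet S') {ω M δ δ' : ℝ} (hω : 0 ≤ ω)
    (hM : ∀ u, |g u| ≤ M) (hM' : ∀ v, |g' v| ≤ M) (hosc : ∀ u ∈ S, ∀ v ∈ S', |g u - g' v| ≤ ω)
    (hδ : μ.real Sᶜ ≤ δ) (hδ' : ν.real S'ᶜ ≤ δ') :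
    |∫ u, g u ∂μ - ∫ v, g' v ∂ν| ≤ ω + 2 * M * (δ + δ') := by
  have i1 : Integrable g μ := integrable_of_continuous_compact hg
  have i2 : Integrable g' ν := integrable_of_continuous_compact hg'
  have hδ0 : 0 ≤ δ := le_trans measureReal_nonneg hδ
  have hIg : |∫ u, g u ∂μ| ≤ M := abs_integral_le_of_forall_abs_le hM
  have hM0 : 0 ≤ M := (abs_nonneg _).trans hIg
  -- step 1: `∫ g dμ` is within `ω + 2Mδ` of every good value `g' v`
  have step : ∀ v ∈ S', |(∫ u, g u ∂μ) - g' v| ≤ ω + 2 * M * δ := fun v hv => by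
    have e : (∫ u, g u ∂μ) - g' v = ∫ u, (g u - g' v) ∂μ := by
      rw [integral_sub i1 (integrable_const _), integral_const]; simp
    rw [e, ← Real.norm_eq_abs]
    have hpt : ∀ᵐ u ∂μ, ‖g u - g' v‖ ≤ ω + 2 * M * Sᶜ.indicator (fun _ => (1 : ℝ)) u :=
      ae_of_all _ fun u => by
        rw [Real.norm_eq_abs]
        by_cases hu : u ∈ S
        · have : Sᶜ.indicator (fun _ => (1 : ℝ)) u = 0 := Set.indicator_of_notMem (by simpa using hu) _
          rw [this, mul_zero, add_zero]
          exact hosc u hu v hv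
        · have : Sᶜ.indicator (fun _ => (1 : ℝ)) u = 1 := Set.indicator_of_mem (by simpa using hu) _
          rw [this, mul_one]
          calc |g u - g' v| ≤ |g u| + |g' v| := abs_sub _ _
            _ ≤ M + M := add_le_add (hM u) (hM' v)
            _ ≤ ω + 2 * M := by linarith
    have key := norm_integral_le_of_norm_le (integrable_const_add_mul_indicator hS.compl ω (2 * M)) hpt
    rw [integral_const_add_mul_indicator hS.compl] at key
    calc ‖∫ u, (g u - g' v) ∂μ‖ ≤ ω + 2 * M * μ.real Sᶜ := key
      _ ≤ ω + 2 * M * δ := by nlinarith [measureReal_nonneg (μ := μ) (s := Sᶜ)]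
  -- step 2: integrate over `ν`, paying `2M` on the bad set `S'ᶜ`
  have e : (∫ u, g u ∂μ) - ∫ v, g' v ∂ν = ∫ v, ((∫ u, g u ∂μ) - g' v) ∂ν := by
    rw [integral_sub (integrable_const _) i2, integral_const]; simp
  rw [e, ← Real.norm_eq_abs]
  have hpt : ∀ᵐ v ∂ν, ‖(∫ u, g u ∂μ) - g' v‖ ≤ (ω + 2 * M * δ) + 2 * M * S'ᶜ.indicator (fun _ => (1 : ℝ)) v :=
    ae_of_all _ fun v => by
      rw [Real.norm_eq_abs]
      by_cases hv : v ∈ S'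
      · have : S'ᶜ.indicator (fun _ => (1 : ℝ)) v = 0 := Set.indicator_of_notMem (by simpa using hv) _
        rw [this, mul_zero, add_zero]
        exact step v hv
      · have : S'ᶜ.indicator (fun _ => (1 : ℝ)) v = 1 := Set.indicator_of_mem (by simpa using hv) _
        rw [this, mul_one]
        calc |(∫ u, g u ∂μ) - g' v| ≤ |∫ u, g u ∂μ| + |g' v| := abs_sub _ _
          _ ≤ M + M := add_le_add hIg (hM' v)
          _ ≤ (ω + 2 * M * δ) + 2 * M := by nlinarith
  have key := norm_integral_le_of_norm_le (integrable_const_add_mul_indicator hS'.compl _ (2 * M)) hpt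
  rw [integral_const_add_mul_indicator hS'.compl] at key
  calc ‖∫ v, ((∫ u, g u ∂μ) - g' v) ∂ν‖ ≤ (ω + 2 * M * δ) + 2 * M * ν.real S'ᶜ := key
    _ ≤ ω + 2 * M * (δ + δ') := by nlinarith [measureReal_nonneg (μ := ν) (s := S'ᶜ)]

/-- **TEMPERED law of total covariance, two-sided.**  Continuous conditional expectations `gAB, gA, gB` of `AB, A, B`
given the exterior, `|gA| ≤ M_A`, `|gB| ≤ M_B`; a measurable GOOD set `S` of exteriors with `μ(Sᶜ) ≤ δ` on which
`gA`, `gB` oscillate by at most `h, h'` (`h, h' ≥ 0`).  Then the total covariance `∫gAB − (∫gA)(∫gB)` is within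
`(h + 2M_Aδ)(h' + 2M_Bδ) + 4M_AM_Bδ` of the mean conditional covariance `∫(gAB − gA gB)` (g4's `h h'` at `δ = 0`).
[folklore] -/
theorem abs_cov_sub_integral_condCov_le_of_osc_on {gA gB gAB : Ω → ℝ} (hA : Continuous gA) (hB : Continuous gB)
    (hAB : Continuous gAB) {S : Set Ω} (hS : MeasurableSet S) {h h' MA MB δ : ℝ} (hh : 0 ≤ h) (hh' : 0 ≤ h')
    (hMA : ∀ ω, |gA ω| ≤ MA) (hMB : ∀ ω, |gB ω| ≤ MB)
    (hoA : ∀ ω ∈ S, ∀ ω' ∈ S, |gA ω - gA ω'| ≤ h) (hoB : ∀ ω ∈ S, ∀ ω' ∈ S, |gB ω - gB ω'| ≤ h')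
    (hδ : μ.real Sᶜ ≤ δ) :
    |(∫ ω, gAB ω ∂μ - (∫ ω, gA ω ∂μ) * (∫ ω, gB ω ∂μ)) - ∫ ω, (gAB ω - gA ω * gB ω) ∂μ| ≤
      (h + 2 * MA * δ) * (h' + 2 * MB * δ) + 4 * MA * MB * δ := by
  set mA := ∫ ω, gA ω ∂μ with hmA
  set mB := ∫ ω, gB ω ∂μ with hmB
  have hδ0 : 0 ≤ δ := le_trans measureReal_nonneg hδ
  have hmAle : |mA| ≤ MA := abs_integral_le_of_forall_abs_le hMA
  have hmBle : |mB| ≤ MB := abs_integral_le_of_forall_abs_le hMB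
  have hdevA : ∀ ω ∈ S, |gA ω - mA| ≤ h + 2 * MA * δ := fun ω hω => abs_sub_integral_le_of_osc_on hA hS hMA hoA hδ hω
  have hdevB : ∀ ω ∈ S, |gB ω - mB| ≤ h' + 2 * MB * δ :=
    fun ω hω => abs_sub_integral_le_of_osc_on hB hS hMB hoB hδ hω
  have hbadA : ∀ ω, |gA ω - mA| ≤ 2 * MA := fun ω => by
    calc |gA ω - mA| ≤ |gA ω| + |mA| := abs_sub _ _
      _ ≤ MA + MA := add_le_add (hMA ω) hmAle
      _ = 2 * MA := by ring
  have hbadB : ∀ ω, |gB ω - mB| ≤ 2 * MB := fun ω => by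
    calc |gB ω - mB| ≤ |gB ω| + |mB| := abs_sub _ _
      _ ≤ MB + MB := add_le_add (hMB ω) hmBle
      _ = 2 * MB := by ring
  have iA : Integrable gA μ := integrable_of_continuous_compact hA
  have iB : Integrable gB μ := integrable_of_continuous_compact hB
  have iAB : Integrable gAB μ := integrable_of_continuous_compact hAB
  have iAgB : Integrable (fun ω => gA ω * gB ω) μ := integrable_of_continuous_compact (hA.mul hB)
  have hsplit : (∫ ω, gAB ω ∂μ - mA * mB) - ∫ ω, (gAB ω - gA ω * gB ω) ∂μ =
      ∫ ω, (gA ω - mA) * (gB ω - mB) ∂μ := by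
    have e : (fun ω => (gA ω - mA) * (gB ω - mB)) =
        fun ω => (gA ω * gB ω - mA * gB ω - mB * gA ω) + mA * mB := by
      funext ω; ring
    have i1 : Integrable (fun ω => gA ω * gB ω - mA * gB ω) μ := iAgB.sub (iB.const_mul mA)
    have i2 : Integrable (fun ω => gA ω * gB ω - mA * gB ω - mB * gA ω) μ := i1.sub (iA.const_mul mB)
    rw [e, integral_add i2 (integrable_const _), integral_sub i1 (iA.const_mul mB),
      integral_sub iAgB (iB.const_mul mA), integral_const_mul, integral_const_mul, integral_const,
      integral_sub iAB iAgB]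
    simp only [probReal_univ, smul_eq_mul, one_mul]
    ring
  rw [hsplit, ← Real.norm_eq_abs]
  have hMA0 : 0 ≤ 2 * MA := by linarith [(abs_nonneg _).trans hmAle]
  have hMB0 : 0 ≤ 2 * MB := by linarith [(abs_nonneg _).trans hmBle]
  have hpt : ∀ᵐ ω ∂μ, ‖(gA ω - mA) * (gB ω - mB)‖ ≤
      (h + 2 * MA * δ) * (h' + 2 * MB * δ) + (4 * MA * MB) * Sᶜ.indicator (fun _ => (1 : ℝ)) ω :=
    ae_of_all _ fun ω => by
      rw [Real.norm_eq_abs, abs_mul]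
      by_cases hω : ω ∈ S
      · have : Sᶜ.indicator (fun _ => (1 : ℝ)) ω = 0 := Set.indicator_of_notMem (by simpa using hω) _
        rw [this, mul_zero, add_zero]
        exact mul_le_mul (hdevA ω hω) (hdevB ω hω) (abs_nonneg _) (by nlinarith)
      · have : Sᶜ.indicator (fun _ => (1 : ℝ)) ω = 1 := Set.indicator_of_mem (by simpa using hω) _
        rw [this, mul_one]
        have hprod : |gA ω - mA| * |gB ω - mB| ≤ 2 * MA * (2 * MB) :=
          mul_le_mul (hbadA ω) (hbadB ω) (abs_nonneg _) hMA0
        nlinarith [hprod, mul_nonneg (by nlinarith : (0:ℝ) ≤ h + 2 * MA * δ) (by nlinarith : (0:ℝ) ≤ h' + 2 * MB * δ)]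
  have key := norm_integral_le_of_norm_le (integrable_const_add_mul_indicator hS.compl _ (4 * MA * MB)) hpt
  rw [integral_const_add_mul_indicator hS.compl] at key
  calc ‖∫ ω, (gA ω - mA) * (gB ω - mB) ∂μ‖
      ≤ (h + 2 * MA * δ) * (h' + 2 * MB * δ) + 4 * MA * MB * μ.real Sᶜ := key
    _ ≤ (h + 2 * MA * δ) * (h' + 2 * MB * δ) + 4 * MA * MB * δ := by
        have : 0 ≤ 4 * MA * MB := by nlinarith
        nlinarith [measureReal_nonneg (μ := μ) (s := Sᶜ)]

end MomentsOn

end Summit.QuantumFields.YangMills.Cruxes.NT.Reference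

end
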